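/-
Copyright (c) 2026. Released under the Apache 2.0 license.
-/
import Literature.NumberTheory.EllipticCurves.QuadraticTwistAtTwoMinimalModelProofs
import Literature.NumberTheory.EllipticCurves.ManinConstantClassCertificateTwistGamma0Proofs
import Literature.NumberTheory.EllipticCurves.QuadraticTwistNegOneLFunctionProofs
import Literature.NumberTheory.EllipticCurves.QuadraticTwistTwoLFunctionProofs
import Literature.NumberTheory.Automorphic.ShimuraCurveRibetTakahashiPeterssonTwistComparisonProofs
import Literature.NumberTheory.Automorphic.ShimuraCurveRibetTakahashiPeterssonTwoPowerLevelSevenProofs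
import HarnessLib

/-!
# The Manin constant under the quadratic twists RAMIFIED AT `2` (`χ₋₄`, `χ₈`, `χ₋₈`):
# Stevens 1989 Lemma (5.2) at conductor `4`, `8` (cases `η = 1`) as a lattice statement, and `2 ∤ c₀`

[Proofs] Theorems only (no definition, no named fact; D-0026). Topic
`Literature/NumberTheory/EllipticCurves`; namespaces `Literature.NumberTheory.EllipticCurves.ModularForms`
(as the sibling Manin-constant files) and `WeierstrassCurve` (dot-notation twisting identities).

`ManinConstantQuadraticTwistGamma0Proofs` proves, on `Γ₀` and for ANY primitive quadratic
character `χ` mod `m` (`m² ∣ N`), the twist step `c₀(𝒜) ∣ c(D')`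
(`maninConstant_dvd_of_charTwist_gamma0`) and `q ∤ c₀(𝒜)` when `q² ∤ N'`
(`not_dvd_maninConstant_of_charTwist_gamma0_of_not_sq_dvd_level`), given a globally minimal `C`
in `𝒜 = 𝒜' ⊗ χ` with Néron lattice `g(χ)⁻¹ Λ_A`. `ManinConstantQuadraticTwistIstarProofs` /
`ManinConstantClassCertificateTwistGamma0Proofs` run it at every ODD `q` (Stevens' Lemma (5.2)
at odd prime conductor, `η = 1` always) and record "`q = 2` is not treated (Stevens' `η`;
conductor `4`, `8`)". This file treats `q = 2`:

* §1 `gaussSum_χ₄_ringHomComp_sq`, `gaussSum_χ₈_ringHomComp_sq`, `gaussSum_χ₈'_ringHomComp_sq`: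
  `g(χ₋₄)² = −4`, `g(χ₈)² = 8`, `g(χ₋₈)² = −8` against `ZMod.stdAddChar` (Montgomery–Vaughan
  Thm. 9.17), by direct evaluation (`exp(2πi/4) = i`, `exp(2πi/8)² = i`). (Mathlib's `gaussSum_sq`
  needs a finite FIELD, so does not cover `ZMod 4`, `ZMod 8`.)
* (inputs, by name) the tree's odd-`n` twisting identities `aₙ(E^{(d)}) = χ_d(n) aₙ(E)`,
  `d ∈ {−1, 2, −2}`, with NO hypothesis at `2`:
  `WeierstrassCurve.LFunction_quadraticTwist_neg_one_apply_of_odd`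
  (`ShimuraCurveRibetTakahashiPeterssonTwistComparisonProofs`),
  `WeierstrassCurve.LFunction_quadraticTwist_two_apply_of_odd` / `…_neg_two_apply_of_odd`
  (`ShimuraCurveRibetTakahashiPeterssonTwoPowerLevelSevenProofs`).
* §2 `isNeronLatticeOf_quadraticTwist_of_sq_eq`: `Λ(W^{(D)}) = s⁻¹ Λ(W)` as Néron-type pairs for
  `s² = D` (Pal 2012, Lemma 3.1, "`ω(E^d) = ω(E)/√d`").
* §3 `neronLattice_quadraticTwist_two` — **Stevens 1989 Lemma (5.2) at conductor `4` and `8`,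
  cases `η = 1`, PROVED**: for `W/ℚ` globally minimal, good or multiplicative at `2`,
  `d ∈ {−1, 2, −2}` with `d = −1 ∨ W multiplicative at 2`, every globally minimal model `C` of
  `W ⊗ χ` (`∃ u, u • W.quadraticTwist d = C`) and every `s` with `s² = 4d` (`= g(χ)²`):
  `z ∈ Λ(C) ↔ s z ∈ Λ(W)`. Mechanism: the equation `W^{(4d)}` is globally minimal
  (`isGloballyMinimal_quadraticTwist_four_mul`, file `QuadraticTwistAtTwoMinimalModelProofs`:
  Connell / Pal 2012 Prop. 2.4 at `p = 2`, Kraus 1989 Prop. 2) with Néron pair `s⁻¹ L`, and two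
  globally minimal models differ by `u = ±1` (`isGloballyMinimal_unique_holds`).
* §4 `not_dvd_maninConstant_of_isTwistOfSemistableAtTwo_gamma0` — **`2 ∤ c₀(𝒜)` when
  `𝒜 = 𝒜' ⊗ χ`, `χ ∈ {χ₋₄, χ₈, χ₋₈}`, `𝒜'` semistable at `2`, and `χ = χ₋₄` or `𝒜'`
  multiplicative at `2`** — binders `hM hAU hC2 hnf` only, the `q = 2` companion of
  `not_dvd_maninConstant_of_isTwistOfSemistableAt_gamma0` with the same displayed-hypothesis shape
  (`W ∼ W'.quadraticTwist d`, `N(W') ∣ N(W)`, `(4|d|)² ∣ N(W)`, `4 ∤ N(W')`, `d = −1 ∨ 2 ∣ N(W')`,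
  `W` additive at `2`); and the `χ`-generic core `…_of_char`.

What this is. For an optimal curve of conductor `N` with `v₂(N) ∈ {4, 6}` whose class is the
`χ₋₄`/`χ_{±8}`-twist of a class with `v₂(N') ≤ 1`, the conclusion `2 ∤ c₀` is the prime-`2`
analogue of Edixhoven 1991 §1's clause for types `I₀*`/`I_ν*` ("already proved by Mazur and
Stevens"), assembled here from printed lemmas (Stevens (5.2)/(5.4) run on `Γ₀`, Shimura 1971
Prop. 3.64, Česnavičius 2018 Thm. 1.2 at `4 ∤ N'`, Connell/Pal at `2`, Kraus at `2`, the Néron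
mapping property); printed nowhere as such; every input is cited at its use. The case `η = 2`
(`χ_{±8}` with `𝒜'` good supersingular at `2`) only gives `c₀ ∣ 2 c(D')` and is not treated; the
case `χ_{±8}` with `𝒜'` good ORDINARY at `2` (`η = 1`) needs the isogeny-invariance of ordinarity
and is left to `isGloballyMinimal_quadraticTwist_four_mul_of_odd_a₁` plus a future per-pair variant.

## References
* [Stevens1989] G. Stevens, *Stickelberger elements and modular parametrizations of elliptic
  curves*, Invent. Math. 98 (1989) 75–106: Lemma (5.2) p. 96, Lemma (5.4) p. 97, (2.8) p. 88.
* [Pal2012] V. Pal, *Periods of quadratic twists of elliptic curves*, Proc. AMS 140 (2012):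
  Lemma 2.2, Remark 2.3, Prop. 2.4 (Connell), Prop. 2.5, Lemma 3.1.
* [Kraus1989] A. Kraus, Acta Arith. 54 (1989), Prop. 2.
* [MontgomeryVaughan2007] H. L. Montgomery, R. C. Vaughan, *Multiplicative Number Theory I*,
  Cambridge (2007), Thm. 9.17 (Gauss sums of primitive quadratic characters).
* [Cesnavicius2018] K. Česnavičius, *The Manin constant in the semistable case*, Compositio Math.
  154 (2018), Thm. 1.2.
* [Mazur1978] B. Mazur, Invent. Math. 44 (1978), Cor. 4.1. [AbbesUllmo1996] A. Abbes, E. Ullmo,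
  Compositio Math. 103 (1996), Thm. A.
* [EdixhovenManin1991] B. Edixhoven, Progr. Math. 89 (1991), §1.
* [SilvermanAEC2009] J. H. Silverman, *The Arithmetic of Elliptic Curves*, 2nd ed., VII.1 Prop.
  1.3(b), VIII.8.3, X.2 Prop. 2.4, X.5 Cor. 5.4 and Exercise 10.16.
-/

noncomputable section

open scoped MatrixGroups ModularForm Classical

open CongruenceSubgroup WeierstrassCurve IsDedekindDomain IsDedekindDomain.HeightOneSpectrum
  NumberField Rat.HeightOneSpectrum Literature.NumberTheory.Automorphic

namespace Literature.NumberTheory.EllipticCurves.ModularForms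

/-! ### 1. The Gauss sums of `χ₋₄`, `χ₈`, `χ₋₈`: `g² = −4, 8, −8` -/

section Gauss

open Complex in
/-- `exp(2πi/4) = i`. [folklore] -/
private theorem exp_two_pi_I_div_four : cexp (2 * Real.pi * I / 4) = I := by
  rw [show (2 * Real.pi * I / 4 : ℂ) = (Real.pi / 2 : ℂ) * I by ring, exp_mul_I,
    Complex.cos_pi_div_two, Complex.sin_pi_div_two]
  simp

open Complex in
/-- `exp(2πi/8)² = i`. [folklore] -/
private theorem exp_two_pi_I_div_eight_sq : cexp (2 * Real.pi * I / 8) ^ 2 = I := by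
  rw [← Complex.exp_nat_mul, show ((2 : ℕ) : ℂ) * (2 * Real.pi * I / 8) = (Real.pi / 2 : ℂ) * I by
    push_cast; ring, exp_mul_I, Complex.cos_pi_div_two, Complex.sin_pi_div_two]
  simp

open Complex in
/-- The standard additive character of `ZMod N` at a natural number: `ψ(a) = exp(2πi/N)ᵃ`.
[folklore] -/
private theorem stdAddChar_natCast (N : ℕ) [NeZero N] (a : ℕ) :
    ZMod.stdAddChar (N := N) (a : ZMod N) = cexp (2 * Real.pi * I / N) ^ a := by
  rw [← Int.cast_natCast, ZMod.stdAddChar_coe, ← Complex.exp_nat_mul]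
  congr 1
  push_cast
  ring

open Complex in
/-- **`g(χ₋₄)² = −4`**: the Gauss sum of the primitive quadratic character mod `4` against the
standard additive character is `ψ(1) − ψ(3) = i − i³ = 2i`: Montgomery–Vaughan Thm. 9.17,
"`τ(χ_d) = √d` (`d > 0`), `i√(−d)` (`d < 0`)" at `d = −4`; here by direct evaluation.
[cite: MontgomeryVaughan2007, Thm. 9.17 (PDF p. 232)] -/
theorem gaussSum_χ₄_ringHomComp_sq :
    gaussSum (ZMod.χ₄.ringHomComp (Int.castRingHom ℂ)) (ZMod.stdAddChar (N := 4)) ^ 2 = -4 := by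
  set τ : ℂ := cexp (2 * Real.pi * I / 4) with hτ
  have hτI : τ = I := exp_two_pi_I_div_four
  have hψ1 : ZMod.stdAddChar (N := 4) 1 = τ := by simpa using stdAddChar_natCast 4 1
  have hψ3 : ZMod.stdAddChar (N := 4) 3 = τ ^ 3 := by simpa using stdAddChar_natCast 4 3
  have hsum : gaussSum (ZMod.χ₄.ringHomComp (Int.castRingHom ℂ)) (ZMod.stdAddChar (N := 4)) =
      ∑ a : Fin 4, (ZMod.χ₄.ringHomComp (Int.castRingHom ℂ)) a * ZMod.stdAddChar (N := 4) a :=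
    rfl
  have hg : gaussSum (ZMod.χ₄.ringHomComp (Int.castRingHom ℂ)) (ZMod.stdAddChar (N := 4)) =
      2 * I := by
    rw [hsum, Fin.sum_univ_four]
    simp only [MulChar.ringHomComp_apply]
    rw [show ZMod.χ₄ (0 : Fin 4) = 0 from rfl, show ZMod.χ₄ (1 : Fin 4) = 1 from rfl,
      show ZMod.χ₄ (2 : Fin 4) = 0 from rfl, show ZMod.χ₄ (3 : Fin 4) = -1 from rfl,
      show ZMod.stdAddChar (N := 4) (1 : Fin 4) = τ from hψ1,
      show ZMod.stdAddChar (N := 4) (3 : Fin 4) = τ ^ 3 from hψ3]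
    simp only [map_zero, zero_mul, map_one, one_mul, zero_add, add_zero, map_neg, neg_mul, hτI]
    rw [pow_succ, I_sq]
    ring
  rw [hg, mul_pow, I_sq]
  norm_num

open Complex in
/-- **`g(χ₈)² = 8`** (`χ₈ = (2/·)`, the character of `ℚ(√2)`): with `ζ = exp(2πi/8)`, `ζ² = i`,
`g = ζ − ζ³ − ζ⁵ + ζ⁷ = ζ(2 − 2i)` and `g² = i(2 − 2i)² = 8` (Montgomery–Vaughan Thm. 9.17 at `d = 8`).
[cite: MontgomeryVaughan2007, Thm. 9.17 (PDF p. 232)] -/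
theorem gaussSum_χ₈_ringHomComp_sq :
    gaussSum (ZMod.χ₈.ringHomComp (Int.castRingHom ℂ)) (ZMod.stdAddChar (N := 8)) ^ 2 = 8 := by
  set τ : ℂ := cexp (2 * Real.pi * I / 8) with hτ
  have hτ2 : τ ^ 2 = I := exp_two_pi_I_div_eight_sq
  have hψ1 : ZMod.stdAddChar (N := 8) 1 = τ := by simpa using stdAddChar_natCast 8 1
  have hψ3 : ZMod.stdAddChar (N := 8) 3 = τ ^ 3 := by simpa using stdAddChar_natCast 8 3
  have hψ5 : ZMod.stdAddChar (N := 8) 5 = τ ^ 5 := by simpa using stdAddChar_natCast 8 5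
  have hψ7 : ZMod.stdAddChar (N := 8) 7 = τ ^ 7 := by simpa using stdAddChar_natCast 8 7
  have hsum : gaussSum (ZMod.χ₈.ringHomComp (Int.castRingHom ℂ)) (ZMod.stdAddChar (N := 8)) =
      ∑ a : Fin 8, (ZMod.χ₈.ringHomComp (Int.castRingHom ℂ)) a * ZMod.stdAddChar (N := 8) a :=
    rfl
  have hg : gaussSum (ZMod.χ₈.ringHomComp (Int.castRingHom ℂ)) (ZMod.stdAddChar (N := 8)) =
      τ * (2 - 2 * I) := by
    rw [hsum, Fin.sum_univ_eight]
    simp only [MulChar.ringHomComp_apply]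
    rw [show ZMod.χ₈ (0 : Fin 8) = 0 from rfl, show ZMod.χ₈ (1 : Fin 8) = 1 from rfl,
      show ZMod.χ₈ (2 : Fin 8) = 0 from rfl, show ZMod.χ₈ (3 : Fin 8) = -1 from rfl,
      show ZMod.χ₈ (4 : Fin 8) = 0 from rfl, show ZMod.χ₈ (5 : Fin 8) = -1 from rfl,
      show ZMod.χ₈ (6 : Fin 8) = 0 from rfl, show ZMod.χ₈ (7 : Fin 8) = 1 from rfl,
      show ZMod.stdAddChar (N := 8) (1 : Fin 8) = τ from hψ1,
      show ZMod.stdAddChar (N := 8) (3 : Fin 8) = τ ^ 3 from hψ3,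
      show ZMod.stdAddChar (N := 8) (5 : Fin 8) = τ ^ 5 from hψ5,
      show ZMod.stdAddChar (N := 8) (7 : Fin 8) = τ ^ 7 from hψ7]
    simp only [map_zero, zero_mul, map_one, one_mul, zero_add, add_zero, map_neg, neg_mul]
    have h3 : τ ^ 3 = τ * I := by rw [pow_succ', hτ2]
    have h5 : τ ^ 5 = -τ := by
      rw [show τ ^ 5 = τ * (τ ^ 2) ^ 2 by ring, hτ2, I_sq]; ring
    have h7 : τ ^ 7 = -(τ * I) := by
      rw [show τ ^ 7 = τ * (τ ^ 2) ^ 2 * τ ^ 2 by ring, hτ2, I_sq]; ring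
    rw [h3, h5, h7]
    ring
  rw [hg, mul_pow, hτ2]
  have : (2 - 2 * I : ℂ) ^ 2 = -8 * I := by
    rw [sub_sq, mul_pow, I_sq]; ring
  rw [this, ← mul_assoc, mul_comm I, mul_assoc, I_mul_I]
  norm_num

open Complex in
/-- **`g(χ₋₈)² = −8`** (`χ₋₈ = χ₈' = (−2/·)`, the character of `ℚ(√−2)`): with `ζ = exp(2πi/8)`,
`g = ζ + ζ³ − ζ⁵ − ζ⁷ = ζ(2 + 2i)` and `g² = i(2 + 2i)² = −8` (Montgomery–Vaughan Thm. 9.17 at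
`d = −8`). [cite: MontgomeryVaughan2007, Thm. 9.17 (PDF p. 232)] -/
theorem gaussSum_χ₈'_ringHomComp_sq :
    gaussSum (ZMod.χ₈'.ringHomComp (Int.castRingHom ℂ)) (ZMod.stdAddChar (N := 8)) ^ 2 = -8 := by
  set τ : ℂ := cexp (2 * Real.pi * I / 8) with hτ
  have hτ2 : τ ^ 2 = I := exp_two_pi_I_div_eight_sq
  have hψ1 : ZMod.stdAddChar (N := 8) 1 = τ := by simpa using stdAddChar_natCast 8 1
  have hψ3 : ZMod.stdAddChar (N := 8) 3 = τ ^ 3 := by simpa using stdAddChar_natCast 8 3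
  have hψ5 : ZMod.stdAddChar (N := 8) 5 = τ ^ 5 := by simpa using stdAddChar_natCast 8 5
  have hψ7 : ZMod.stdAddChar (N := 8) 7 = τ ^ 7 := by simpa using stdAddChar_natCast 8 7
  have hsum : gaussSum (ZMod.χ₈'.ringHomComp (Int.castRingHom ℂ)) (ZMod.stdAddChar (N := 8)) =
      ∑ a : Fin 8, (ZMod.χ₈'.ringHomComp (Int.castRingHom ℂ)) a * ZMod.stdAddChar (N := 8) a :=
    rfl
  have hg : gaussSum (ZMod.χ₈'.ringHomComp (Int.castRingHom ℂ)) (ZMod.stdAddChar (N := 8)) =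
      τ * (2 + 2 * I) := by
    rw [hsum, Fin.sum_univ_eight]
    simp only [MulChar.ringHomComp_apply]
    rw [show ZMod.χ₈' (0 : Fin 8) = 0 from rfl, show ZMod.χ₈' (1 : Fin 8) = 1 from rfl,
      show ZMod.χ₈' (2 : Fin 8) = 0 from rfl, show ZMod.χ₈' (3 : Fin 8) = 1 from rfl,
      show ZMod.χ₈' (4 : Fin 8) = 0 from rfl, show ZMod.χ₈' (5 : Fin 8) = -1 from rfl,
      show ZMod.χ₈' (6 : Fin 8) = 0 from rfl, show ZMod.χ₈' (7 : Fin 8) = -1 from rfl,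
      show ZMod.stdAddChar (N := 8) (1 : Fin 8) = τ from hψ1,
      show ZMod.stdAddChar (N := 8) (3 : Fin 8) = τ ^ 3 from hψ3,
      show ZMod.stdAddChar (N := 8) (5 : Fin 8) = τ ^ 5 from hψ5,
      show ZMod.stdAddChar (N := 8) (7 : Fin 8) = τ ^ 7 from hψ7]
    simp only [map_zero, zero_mul, map_one, one_mul, zero_add, add_zero, map_neg, neg_mul]
    have h3 : τ ^ 3 = τ * I := by rw [pow_succ', hτ2]
    have h5 : τ ^ 5 = -τ := by
      rw [show τ ^ 5 = τ * (τ ^ 2) ^ 2 by ring, hτ2, I_sq]; ring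
    have h7 : τ ^ 7 = -(τ * I) := by
      rw [show τ ^ 7 = τ * (τ ^ 2) ^ 2 * τ ^ 2 by ring, hτ2, I_sq]; ring
    rw [h3, h5, h7]
    ring
  rw [hg, mul_pow, hτ2]
  have : (2 + 2 * I : ℂ) ^ 2 = 8 * I := by
    rw [add_sq, mul_pow, I_sq]; ring
  rw [this, ← mul_assoc, mul_comm I, mul_assoc, I_mul_I]
  norm_num

end Gauss

end Literature.NumberTheory.EllipticCurves.ModularForms

namespace WeierstrassCurve

open Literature.NumberTheory.EllipticCurves Literature.NumberTheory.EllipticCurves.ModularForms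

/-! ### 2. The Néron-type pair of the twisted equation `W^{(D)}` -/

/-- **`Λ(W^{(D)}) = s⁻¹ Λ(W)` as Néron-type pairs, `s² = D`**: `c₄ ↦ D² c₄`, `c₆ ↦ D³ c₆` under
`quadraticTwist D` and `g₂(s⁻¹Λ) = s⁴ g₂(Λ)`, `g₃(s⁻¹Λ) = s⁶ g₃(Λ)`. Pal 2012, Lemma 3.1
("`ω(E^d) = ω(E)/√d`"). [cite: Pal2012, Lemma 3.1 and Remark 2.3] -/
theorem isNeronLatticeOf_quadraticTwist_of_sq_eq {W : WeierstrassCurve ℚ} (D : ℚ) {L : PeriodPair}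
    (hL : IsNeronLatticeOf (W.baseChange ℂ) L) {s : ℂ} (hs0 : s ≠ 0) (hs : s ^ 2 = (D : ℂ)) :
    IsNeronLatticeOf ((W.quadraticTwist D).baseChange ℂ) (L.mulLeft s⁻¹ (inv_ne_zero hs0)) := by
  have hT : (W.quadraticTwist D).baseChange ℂ = (W.baseChange ℂ).quadraticTwist ((D : ℚ) : ℂ) := by
    simp only [WeierstrassCurve.baseChange, map_quadraticTwist, eq_ratCast]
  constructor
  · rw [PeriodPair.g₂_mulLeft, hL.1, hT, quadraticTwist_c₄, ← hs, inv_pow, inv_inv]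
    ring
  · rw [PeriodPair.g₃_mulLeft, hL.2, hT, quadraticTwist_c₆, ← hs, inv_pow, inv_inv]
    ring

end WeierstrassCurve

namespace Literature.NumberTheory.EllipticCurves.ModularForms

/-! ### 3. Stevens 1989 Lemma (5.2) at conductor `4` and `8` (`η = 1`): `Λ(W ⊗ χ) = g(χ)⁻¹ Λ(W)` -/

section Stevens

variable {W : WeierstrassCurve ℚ} [W.IsElliptic] [W.IsGloballyMinimal]

/-- **Stevens 1989, Lemma (5.2), for the quadratic characters of conductor `4` and `8` in the cases
`η = 1` — PROVED.** Let `W/ℚ` be globally minimal with good or multiplicative reduction at `2`,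
`L` a Néron-type pair of `W`, `d ∈ {−1, 2, −2}` with `d = −1` or `W` multiplicative at `2`, `C` any
globally minimal model of the twist `W.quadraticTwist d` (`= W ⊗ χ`, `χ = χ₋₄, χ₈, χ₋₈`) with
Néron-type pair `L'`, and `s² = 4d` (`= g(χ)²`: `gaussSum_χ₄_ringHomComp_sq` etc.). Then
`z ∈ Λ(C) ↔ s z ∈ Λ(W)`, i.e. `Λ(C) = s⁻¹ Λ(W)` ("`ℒ(A^ψ) = (η/τ(ψ)) ℒ(A)`", `η = 1`). Proof: the
globally minimal equation `T = W^{(4d)}` (`isGloballyMinimal_quadraticTwist_four_mul`) has Néron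
pair `s⁻¹ L` (`isNeronLatticeOf_quadraticTwist_of_sq_eq`), `C = w • T` with `w.u = ±1`
(`isGloballyMinimal_unique_holds`), so `Λ(C) = Λ(T)`. [cite: Stevens1989, Lemma (5.2) p. 96]
[cite: Pal2012, Prop. 2.5 and Lemma 3.1] [cite: SilvermanAEC2009, VII.1 Prop. 1.3(b), VIII.8.3] -/
theorem neronLattice_quadraticTwist_two {L : PeriodPair} (hL : IsNeronLatticeOf (W.baseChange ℂ) L)
    {d : ℤ} (hd : d = -1 ∨ d = 2 ∨ d = -2)
    (hsemi : W.HasGoodReductionAtPrime 2 ∨ W.HasMultiplicativeReductionAtPrime 2)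
    (hη : d = -1 ∨ W.HasMultiplicativeReductionAtPrime 2)
    (C : WeierstrassCurve ℚ) [C.IsElliptic] [C.IsGloballyMinimal]
    (hCtw : ∃ u : VariableChange ℚ, u • W.quadraticTwist (d : ℚ) = C) {L' : PeriodPair}
    (hL' : IsNeronLatticeOf (C.baseChange ℂ) L') {s : ℂ} (hs : s ^ 2 = ((4 * d : ℤ) : ℂ)) (z : ℂ) :
    z ∈ L'.lattice ↔ s * z ∈ L.lattice := by
  have hdZ : d ≠ 0 := by rcases hd with rfl | rfl | rfl <;> norm_num
  have hd0 : (d : ℚ) ≠ 0 := by exact_mod_cast hdZ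
  have hs0 : s ≠ 0 := by
    rintro rfl
    have h0 : ((4 * d : ℤ) : ℂ) = 0 := by rw [← hs]; simp
    have h4d : (4 * d : ℤ) ≠ 0 := mul_ne_zero (by norm_num) hdZ
    exact h4d (by exact_mod_cast h0)
  -- the globally minimal twisted equation `T`, with Néron pair `s⁻¹ L`
  set T : WeierstrassCurve ℚ := W.quadraticTwist (4 * (d : ℚ)) with hT
  haveI hTmin : T.IsGloballyMinimal := isGloballyMinimal_quadraticTwist_four_mul W hd hsemi hη
  have hLT : IsNeronLatticeOf (T.baseChange ℂ) (L.mulLeft s⁻¹ (inv_ne_zero hs0)) :=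
    isNeronLatticeOf_quadraticTwist_of_sq_eq (4 * (d : ℚ)) hL hs0 (by rw [hs]; push_cast; ring)
  -- `C = w • T`
  obtain ⟨u, hu⟩ := hCtw
  obtain ⟨E, hE⟩ := W.exists_variableChange_quadraticTwist_mul_sq (d : ℚ) 2 two_ne_zero
  have hET : E • W.quadraticTwist (d : ℚ) = T := by rw [hE, hT]; congr 1; ring
  have hCw : C = (u * E⁻¹) • T := by rw [mul_smul, ← hET, inv_smul_smul, hu]
  haveI : (W.quadraticTwist (d : ℚ)).IsElliptic := W.isElliptic_quadraticTwist hd0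
  haveI : T.IsElliptic := by rw [← hET]; infer_instance
  haveI : ((u * E⁻¹) • T).IsGloballyMinimal := by rw [← hCw]; infer_instance
  -- `u = ±1`
  have hu1 : (u * E⁻¹).u = 1 ∨ (u * E⁻¹).u = -1 := (isGloballyMinimal_unique_holds T (u * E⁻¹)).1
  -- `Λ(C) = u · s⁻¹ Λ(W)`
  have hL'T : IsNeronLatticeOf (((u * E⁻¹) • T).baseChange ℂ) L' := by rw [← hCw]; exact hL'
  have hΛ := IsNeronLatticeOf.lattice_eq_mulLeft_of_smul (u * E⁻¹) hLT hL'T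
  rw [hΛ, PeriodPair.mem_mulLeft_lattice, PeriodPair.mem_mulLeft_lattice, inv_inv, ← mul_assoc]
  rcases hu1 with h1 | h1
  · rw [h1]; simp
  · rw [h1]
    simp only [Units.val_neg, Units.val_one, Rat.cast_neg, Rat.cast_one, inv_neg, inv_one,
      mul_neg, mul_one, neg_mul]
    exact neg_mem_iff

end Stevens

/-! ### 4. `2 ∤ c₀(𝒜)` when `𝒜 = 𝒜' ⊗ χ` (`χ = χ₋₄, χ₈, χ₋₈`) with `𝒜'` semistable at `2` -/

section Manin

variable {W : WeierstrassCurve ℚ} [W.IsElliptic]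
  {W' : WeierstrassCurve ℚ} [W'.IsElliptic] [W'.IsGloballyMinimal]

/-- The core of the per-pair certificate at `2`, for a given primitive quadratic character `χ`
mod `m` with `g(χ)² = 4d`, `m² ∣ N(W)`, carrying the odd-`n` twisting identity
`aₙ(W' ⊗ d) = χ(n) aₙ(W')` and vanishing at even `n`. See
`not_dvd_maninConstant_of_isTwistOfSemistableAtTwo_gamma0` for the statement with
`χ ∈ {χ₋₄, χ₈, χ₋₈}` supplied. [cite: Stevens1989, Lemmas (5.2), (5.4)]
[cite: Cesnavicius2018, Thm. 1.2] -/
theorem not_dvd_maninConstant_of_isTwistOfSemistableAtTwo_gamma0_of_char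
    (hM : mazur_not_dvd_maninConstant_of_odd)
    (hAU : abbesUllmo_not_dvd_maninConstant_of_not_dvd_level)
    (hC2 : cesnavicius_not_two_dvd_maninConstant_of_two_dvd_level) (hnf : exists_isNewformOf)
    {d : ℤ} (hd : d = -1 ∨ d = 2 ∨ d = -2)
    {m : ℕ} [NeZero m] {χ : DirichletCharacter ℂ m} (hχq : χ.IsQuadratic) (hχp : χ.IsPrimitive)
    (hG : gaussSum χ (ZMod.stdAddChar (N := m)) ^ 2 = ((4 * d : ℤ) : ℂ))
    (hχodd : ∀ n : ℕ, ¬ 2 ∣ n →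
      (((W'.quadraticTwist (d : ℚ)).LFunction n : ℤ) : ℂ) = χ n * ((W'.LFunction n : ℤ) : ℂ))
    (hχeven : ∀ n : ℕ, 2 ∣ n → χ n = 0)
    (htw : IsIsogenous W (W'.quadraticTwist (d : ℚ)))
    (hN'N : W'.conductorNorm ℤ ∣ W.conductorNorm ℤ) (hmN : m ^ 2 ∣ W.conductorNorm ℤ)
    (h4N' : ¬ 2 ^ 2 ∣ W'.conductorNorm ℤ) (hη : d = -1 ∨ 2 ∣ W'.conductorNorm ℤ)
    (hadd : ¬ W.HasGoodReductionAtPrime 2 ∧ ¬ W.HasMultiplicativeReductionAtPrime 2)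
    (W₀ : WeierstrassCurve ℚ) [W₀.IsElliptic] [W₀.IsGloballyMinimal] {N₀ : ℕ} [NeZero N₀]
    (D₀ : ModularParametrizationData W₀ N₀) (hiso : IsIsogenous W W₀)
    (h₀ : ∀ z ∈ D₀.L.lattice, ∃ w ∈ periodLattice D₀.f, z = D₀.c * w) :
    ¬ (2 : ℤ) ∣ D₀.maninConstant := by
  haveI : Fact (Nat.Prime 2) := ⟨Nat.prime_two⟩
  have hdZ : d ≠ 0 := by rcases hd with rfl | rfl | rfl <;> norm_num
  have hd0 : (d : ℚ) ≠ 0 := by exact_mod_cast hdZ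
  -- the levels are the conductors
  have hLW₀ : W.LFunction = W₀.LFunction := LFunction_eq_of_isIsogenous_holds W W₀ hiso
  have hnfW : IsNewformOf W D₀.f :=
    ⟨D₀.isNewformOf.1, fun n ↦ by rw [D₀.isNewformOf.2 n, hLW₀]⟩
  have hN₀ : N₀ = W.conductorNorm ℤ :=
    IsNewformOf.level_eq_conductorNorm_of_exists_isNewformOf hnf hnfW
  haveI : NeZero (W'.conductorNorm ℤ) := ⟨(conductorNorm_pos_holds W').ne'⟩
  -- the optimal `X₀`-datum `D'` of `𝒜'`, on a globally minimal `W₁' ∼ W'`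
  obtain ⟨f', hf'⟩ := hnf W'
  obtain ⟨W₁', hE₁', hM₁', D', hD'f, -, hmin⟩ :=
    exists_optimal_modularParametrizationData_of_isNewformOf' (W'.conductorNorm ℤ) W' rfl hf'
  haveI := hE₁'
  haveI := hM₁'
  have hopt' : ∀ z ∈ D'.L.lattice, ∃ w ∈ periodLattice D'.f, z = D'.c * w :=
    D'.latticeEq_of_forall_modularDegree_le fun W₂ _ D₂ h2 ↦ hmin W₂ D₂ (h2.trans hD'f)
  -- `W₁'` is semistable at `2` (its conductor is the level `N(W')`, `4 ∤ N(W')`), and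
  -- multiplicative there when `2 ∣ N(W')`
  have hN'₁ : W'.conductorNorm ℤ = W₁'.conductorNorm ℤ :=
    IsNewformOf.level_eq_conductorNorm_of_exists_isNewformOf hnf D'.isNewformOf
  have hsemi : W₁'.HasGoodReductionAtPrime 2 ∨ W₁'.HasMultiplicativeReductionAtPrime 2 :=
    hasGoodReductionAtPrime_or_hasMultiplicativeReductionAtPrime_of_not_sq_dvd_conductorNorm
      (by rw [← hN'₁]; exact h4N')
  have hη₁ : d = -1 ∨ W₁'.HasMultiplicativeReductionAtPrime 2 := by
    rcases hη with h | h2N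
    · exact Or.inl h
    · right
      rcases hsemi with hg | hm'
      · -- good at `2` would give `f₂ = 0`, contradicting `2 ∣ N(W₁')`
        exfalso
        set v2 : HeightOneSpectrum ℤ := (primesEquiv (R := ℤ)).symm ⟨2, Nat.prime_two⟩ with hv2
        have hg' : W₁'.HasGoodReductionAt v2 :=
          (W₁'.hasGoodReductionAtPrime_iff_hasGoodReductionAt_holds ⟨2, Nat.prime_two⟩).mp hg
        have hf0 : W₁'.conductorExponent v2 = 0 := (conductorExponent_eq_zero_iff_holds v2 W₁').mpr hg'
        have hfac : (W₁'.conductorNorm ℤ).factorization 2 = 0 := by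
          rw [show (2 : ℕ) = ((⟨2, Nat.prime_two⟩ : Nat.Primes) : ℕ) from rfl,
            factorization_conductorNorm_primesEquiv_symm W₁' ⟨2, Nat.prime_two⟩, ← hv2, hf0]
        rw [hN'₁] at h2N
        have := (Nat.prime_two.dvd_iff_one_le_factorization (conductorNorm_pos_holds W₁').ne').mp h2N
        omega
      · exact hm'
  -- the minimal model `C` of `W₁' ⊗ χ` and a Néron pair of it
  haveI : (W₁'.quadraticTwist (d : ℚ)).IsElliptic := W₁'.isElliptic_quadraticTwist hd0
  obtain ⟨vC, hvC⟩ := hasGlobalMinimalModel_rat_holds (W₁'.quadraticTwist (d : ℚ))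
  haveI := hvC
  haveI : ((vC • W₁'.quadraticTwist (d : ℚ)).baseChange ℂ).IsElliptic := by
    rw [WeierstrassCurve.baseChange]; infer_instance
  obtain ⟨LC, hC⟩ := exists_isNeronLatticeOf_holds ((vC • W₁'.quadraticTwist (d : ℚ)).baseChange ℂ)
  -- Stevens (5.2) at `2`: `Λ_C = g(χ)⁻¹ Λ_{W₁'}`
  have hLC : ∀ z : ℂ, z ∈ LC.lattice ↔ gaussSum χ (ZMod.stdAddChar (N := m)) * z ∈ D'.L.lattice :=
    fun z ↦ neronLattice_quadraticTwist_two D'.isNeronLattice hd hsemi hη₁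
      (vC • W₁'.quadraticTwist (d : ℚ)) ⟨vC, rfl⟩ hC hG z
  -- the newform of `𝒜` is the `χ`-twist of that of `𝒜'`
  have hLtw : W.LFunction = (W'.quadraticTwist (d : ℚ)).LFunction := by
    haveI : (W'.quadraticTwist (d : ℚ)).IsElliptic := W'.isElliptic_quadraticTwist hd0
    exact LFunction_eq_of_isIsogenous_holds _ _ htw
  have hf : ∀ n : ℕ, cuspCoeff D₀.f n = χ n * cuspCoeff D'.f n := by
    intro n
    have hLn : W₀.LFunction n = W.LFunction n := by rw [hLW₀]
    rw [D₀.isNewformOf.2 n, hD'f, hf'.2 n, hLn]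
    by_cases h2n : 2 ∣ n
    · have h0 : W.LFunction n = 0 :=
        W.LFunction_apply_eq_zero_of_not_good_of_not_mult 2 hadd.1 hadd.2 h2n
      rw [h0, hχeven n h2n]
      simp
    · have hLn' : W.LFunction n = (W'.quadraticTwist (d : ℚ)).LFunction n := by rw [hLtw]
      rw [hLn', hχodd n h2n]
  -- conductor bookkeeping at level `N₀ = N(W)`
  have hN : W'.conductorNorm ℤ ∣ N₀ := by rw [hN₀]; exact hN'N
  have hm : m ^ 2 ∣ N₀ := by rw [hN₀]; exact hmN
  exact not_dvd_maninConstant_of_charTwist_gamma0_of_not_sq_dvd_level hM hAU hC2 D₀ h₀ D' hopt'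
    hχq hχp hN hm hf hC hLC Nat.prime_two h4N'

/-- **`2 ∤ c₀(𝒜)` for a class `𝒜` that is the twist of a class `𝒜'` SEMISTABLE AT `2` by a
quadratic character RAMIFIED ONLY AT `2` (`χ₋₄`, `χ₈`, `χ₋₈`: `𝒜 = 𝒜' ⊗ ℚ(√d)`, `d ∈ {−1, 2, −2}`),
in the cases `η = 1` of Stevens' Lemma (5.2): `d = −1`, or `𝒜'` multiplicative at `2`** — the
`q = 2` companion of `not_dvd_maninConstant_of_isTwistOfSemistableAt_gamma0`, on the `Γ₀` road,
binders `hM hAU hC2 hnf` ONLY. Displayed hypotheses: `W ∈ 𝒜` (any model), `W' ∈ 𝒜'` globally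
minimal, `W ∼ W'.quadraticTwist d`; `N(W') ∣ N(W)`; `(4|d|)² ∣ N(W)` (the level of the twisting
theorem: `16 ∣ N` for `χ₋₄`, `64 ∣ N` for `χ_{±8}`); `4 ∤ N(W')` (`𝒜'` semistable at `2`);
`d = −1 ∨ 2 ∣ N(W')` (`η = 1`); `W` additive at `2`. Conclusion: every lattice-optimal `X₀`-datum
`D₀` of every globally minimal `W₀ ∼ W` has `2 ∤ D₀.maninConstant`. Proof: the optimal `X₀`-datum
`D'` of `𝒜'` (modularity, `exists_optimal_modularParametrizationData_of_isNewformOf'`) lives on a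
globally minimal `W₁'` with `N(W₁') = N(W')`, semistable at `2` and multiplicative there if
`2 ∣ N(W')`; `Λ(C) = g(χ)⁻¹ Λ(W₁')` for the minimal model `C` of `W₁' ⊗ χ`
(`neronLattice_quadraticTwist_two`, with `g(χ)² = 4d`); `aₙ(f_{D₀}) = χ(n) aₙ(f_{D'})` (odd `n`:
the tree's `LFunction_quadraticTwist_*_apply_of_odd` and isogeny invariance; even `n`: additivity of `W` at
`2` and `χ(n) = 0`); then `not_dvd_maninConstant_of_charTwist_gamma0_of_not_sq_dvd_level` at
`q = 2` (`c(D₀) ∣ c(D')` and `2 ∤ c(D')` by Česnavičius 2018 at `4 ∤ N(W')`).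
[cite: Stevens1989, Lemmas (5.2), (5.4) pp. 96–97] [cite: Cesnavicius2018, Thm. 1.2]
[cite: Mazur1978, Cor. 4.1] [cite: AbbesUllmo1996, Thm. A] -/
theorem not_dvd_maninConstant_of_isTwistOfSemistableAtTwo_gamma0
    (hM : mazur_not_dvd_maninConstant_of_odd)
    (hAU : abbesUllmo_not_dvd_maninConstant_of_not_dvd_level)
    (hC2 : cesnavicius_not_two_dvd_maninConstant_of_two_dvd_level) (hnf : exists_isNewformOf)
    {d : ℤ} (hd : d = -1 ∨ d = 2 ∨ d = -2)
    (htw : IsIsogenous W (W'.quadraticTwist (d : ℚ)))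
    (hN'N : W'.conductorNorm ℤ ∣ W.conductorNorm ℤ)
    (hmN : (4 * d.natAbs) ^ 2 ∣ W.conductorNorm ℤ)
    (h4N' : ¬ 2 ^ 2 ∣ W'.conductorNorm ℤ) (hη : d = -1 ∨ 2 ∣ W'.conductorNorm ℤ)
    (hadd : ¬ W.HasGoodReductionAtPrime 2 ∧ ¬ W.HasMultiplicativeReductionAtPrime 2)
    (W₀ : WeierstrassCurve ℚ) [W₀.IsElliptic] [W₀.IsGloballyMinimal] {N₀ : ℕ} [NeZero N₀]
    (D₀ : ModularParametrizationData W₀ N₀) (hiso : IsIsogenous W W₀)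
    (h₀ : ∀ z ∈ D₀.L.lattice, ∃ w ∈ periodLattice D₀.f, z = D₀.c * w) :
    ¬ (2 : ℤ) ∣ D₀.maninConstant := by
  rcases hd with rfl | rfl | rfl
  · -- `χ₋₄`
    refine not_dvd_maninConstant_of_isTwistOfSemistableAtTwo_gamma0_of_char hM hAU hC2 hnf
      (Or.inl rfl) isQuadratic_χ₄_ringHomComp isPrimitive_χ₄_ringHomComp
      (by rw [gaussSum_χ₄_ringHomComp_sq]; norm_num) (fun n hn ↦ ?_) (fun n hn ↦ ?_) htw hN'N
      (by simpa using hmN) h4N' hη hadd W₀ D₀ hiso h₀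
    · rw [show ((-1 : ℤ) : ℚ) = -1 by norm_num, W'.LFunction_quadraticTwist_neg_one_apply_of_odd hn,
        Int.cast_mul, χ₄_ringHomComp_apply_natCast]
    · rw [χ₄_ringHomComp_apply_natCast, ZMod.χ₄_nat_eq_if_mod_four, if_pos (Nat.mod_eq_zero_of_dvd hn)]
      simp
  · -- `χ₈`
    refine not_dvd_maninConstant_of_isTwistOfSemistableAtTwo_gamma0_of_char hM hAU hC2 hnf
      (Or.inr (Or.inl rfl)) isQuadratic_χ₈_ringHomComp isPrimitive_χ₈_ringHomComp
      (by rw [gaussSum_χ₈_ringHomComp_sq]; norm_num) (fun n hn ↦ ?_) (fun n hn ↦ ?_) htw hN'N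
      (by simpa using hmN) h4N' hη hadd W₀ D₀ hiso h₀
    · rw [show ((2 : ℤ) : ℚ) = 2 by norm_num, W'.LFunction_quadraticTwist_two_apply_of_odd hn,
        Int.cast_mul, χ₈_ringHomComp_apply_natCast]
    · rw [χ₈_ringHomComp_apply_natCast, ZMod.χ₈_nat_eq_if_mod_eight,
        if_pos ((Nat.mod_eq_zero_of_dvd hn))]
      simp
  · -- `χ₋₈`
    refine not_dvd_maninConstant_of_isTwistOfSemistableAtTwo_gamma0_of_char hM hAU hC2 hnf
      (Or.inr (Or.inr rfl)) isQuadratic_χ₈'_ringHomComp isPrimitive_χ₈'_ringHomComp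
      (by rw [gaussSum_χ₈'_ringHomComp_sq]; norm_num) (fun n hn ↦ ?_) (fun n hn ↦ ?_) htw hN'N
      (by simpa using hmN) h4N' hη hadd W₀ D₀ hiso h₀
    · rw [show ((-2 : ℤ) : ℚ) = -2 by norm_num, W'.LFunction_quadraticTwist_neg_two_apply_of_odd hn,
        Int.cast_mul, χ₈'_ringHomComp_apply_natCast]
    · rw [χ₈'_ringHomComp_apply_natCast, ZMod.χ₈'_nat_eq_if_mod_eight,
        if_pos ((Nat.mod_eq_zero_of_dvd hn))]
      simp

end Manin

end Literature.NumberTheory.EllipticCurves.ModularForms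

end
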